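import Literature.AlgebraicGeometry.HodgeTheory.ConjugationChartExistence
import Literature.AlgebraicGeometry.HodgeTheory.TorusRationalClasses
import Literature.Geometry.Kaehler.ComplexTorusElementaryMatrices
import Literature.NumberTheory.Transcendental.DeRhamTheoremProofs
import HarnessLib

/-!
# A natural, rationally normalised complex de Rham family exists
# (discharge of the named fact `exists_isRational_complexDeRhamIsoFamily`)

`ConjugationChartExistence` names, as input (R) of the existence of conjugation charts
(`AbsoluteHodgeClasses.ConjugationChart`, field `deRham_isRational`), the fact
`exists_isRational_complexDeRhamIsoFamily`: over every finite-dimensional complex model space `E` there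
is a complex de Rham isomorphism family which is NATURAL and RATIONALLY NORMALISED in every degree
(`IsRationalDeRhamFamily e k`: on each torus `E/Φ(ℤ^ι)` the class of a constant `k`-form with rational
values on the lattice `k`-tuples is a rational class). This file PROVES it
(`exists_isRational_complexDeRhamIsoFamily_holds`), from de Rham's theorem as proved in the tree
(`exists_complexDeRhamIsoFamily_holds`: the complexified integration family `e₀` is natural) WITHOUT a
period computation, by a rational rescaling degree by degree:

1. (§1) naturality transports rational classes of invariant forms between two tori on `E` along the
   homomorphisms `mapMatrix A` (`isRationalClass_cconstClass_comp_realRep₂`);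
2. (§2, one torus) if ONE invariant `k`-form `γ₀` has a rational class, then for its `w`-coordinate
   `g = γ₀(Φe_w)` every lattice-rational `a` has `e₀[g · a]` rational: `a = Σ_u a(Φe_u) dx_u` and
   `g · dx_u = γ₀ ∘ ρ(B(w,u))` for the elementary integer matrices `B(w,u)`
   (`ComplexTorus.comp_realRep_elemMatrix`), Lange–Birkenhake §1.1.2/§1.1.4;
3. (§3, reference torus `E/Φ₀(ℤᴺ)`, `N = dim_ℝ E`, whose underlying space is literally `Tᴺ = (ℝ/ℤ)ᴺ`)
   a non-zero rational invariant form exists whenever `Altᵏ ≠ 0`: transport a cup monomial of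
   `Hᵏ(Tᴺ; ℂ)` (`torusMonomialBasis`, `isRationalClass_torusMonomial`, Hatcher Ex. 3.16) back through
   `e₀` and `cconstClassEquiv`; with 2. this gives ONE scalar `g_k ≠ 0` per degree
   (`exists_scale_isRationalClass`);
4. (§4) `e := e₀ ∘ (g_k ·)` is natural, and rationally normalised on EVERY torus `E/Φ(ℤ^ι)`: a
   bijection `ι ≃ Fin N` gives `mapMatrix P : E/Φ(ℤ^ι) → E/Φ₀(ℤᴺ)` with linear lift `S`,
   `S(Φe_c) = Φ₀e_{βc}`, so `a = γ ∘ S` with `γ = a ∘ S⁻¹` lattice-rational for `Φ₀`, and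
   `e₀[g_k a] = (mapMatrix P)^* e₀[g_k γ]` is rational by 1.

So the witness is a rational rescaling of the integration family; identifying `g_k` with `1` (the
period computation `∫_{T_I} dx_I = 1`, Griffiths–Harris Ch. 2 §6) is not needed for the fact. Net
effect on the trust base of `ConjugationChartExistence`: (R) discharged; (J), (G), (C) remain.

## References

* H. Lange, Ch. Birkenhake, *Complex Abelian Varieties* (1992), §1.1.2, §1.1.4 Prop. 1.1.20.
* A. Hatcher, *Algebraic Topology* (2002), §3.2 Example 3.16.
* P. Griffiths, J. Harris, *Principles of Algebraic Geometry* (1978), Ch. 2 §6.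
-/

noncomputable section

open scoped Manifold ContDiff
open ContinuousAlternatingMap Function
open Literature.NumberTheory.Transcendental Literature.Geometry.Kaehler
open Literature.AlgebraicTopology.SingularHomology Literature.LinearAlgebra.Alternating

/-! ### §1 Rational classes of invariant forms pull back between two tori on the same model space -/

namespace Literature.AlgebraicGeometry.HodgeTheory

section HodgeTheory

variable {ι ι' : Type} [Fintype ι] [Fintype ι'] {E : Type} [NormedAddCommGroup E] [NormedSpace ℂ E]
  (Φ : (ι → ℝ) ≃L[ℝ] E) (Φ' : (ι' → ℝ) ≃L[ℝ] E) {k : ℕ}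

/-- **Rational classes of invariant forms pull back to rational classes of invariant forms**
between two tori on the same model space, for a NATURAL comparison family:
if `e[c]` is rational on `E/Φ'(ℤ^ι')` then `e[c ∘ ρ(A)]` is rational on `E/Φ(ℤ^ι)`.
[cite: LangeBirkenhake1992, §1.1.2] -/
theorem isRationalClass_cconstClass_comp_realRep₂ {e : ComplexDeRhamIsoFamily E} (he : e.IsNatural)
    (A : Matrix ι' ι ℤ) {c : E [⋀^Fin k]→L[ℝ] ℂ}
    (hc : IsRationalClass (e (ComplexTorus Φ') k (ComplexTorus.cconstClass Φ' c))) :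
    IsRationalClass (e (ComplexTorus Φ) k
      (ComplexTorus.cconstClass Φ (c.compContinuousLinearMap (ComplexTorus.realRep Φ Φ' A)))) := by
  have hF := ComplexTorus.contMDiff_real_mapMatrix (Φ := Φ) (Φ' := Φ') (n := ∞) A
  rw [← ComplexTorus.cmap_cconstClass_mapMatrix₂ Φ Φ' A c, he _ _ _ hF k]
  exact hc.pullback _

/-! ### §2 On one torus: a rational invariant form scales the lattice-rational forms into the rational classes -/

section OneTorus

variable {ι₀ : Type} [Fintype ι₀] [LinearOrder ι₀] (Φ₀ : (ι₀ → ℝ) ≃L[ℝ] E)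

/-- **Scaling lemma.** On a torus `E/Φ₀(ℤ^ι₀)` with a NATURAL comparison family `e`: if `γ₀` is an
invariant `k`-form whose class `e[γ₀]` is rational, then for its `w`-coordinate
`g = γ₀(Φ₀e_{w 0}, …)` and every invariant form `a` with RATIONAL values on the lattice `k`-tuples, the
class `e[g · a]` is rational: `a = Σ_u a(Φ₀e_u) dx_u` over increasing `u` and
`g · dx_u = γ₀ ∘ ρ(B(w, u))` (`comp_realRep_elemMatrix`), whose class is `(mapMatrix B)^* e[γ₀]`.
[cite: LangeBirkenhake1992, §1.1.2 and §1.1.4 Prop. 1.1.20] -/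
theorem isRationalClass_cconstClass_coord_smul {e : ComplexDeRhamIsoFamily E} (he : e.IsNatural)
    {γ₀ : E [⋀^Fin k]→L[ℝ] ℂ}
    (hγ₀ : IsRationalClass (e (ComplexTorus Φ₀) k (ComplexTorus.cconstClass Φ₀ γ₀)))
    (w : Fin k → ι₀) (a : E [⋀^Fin k]→L[ℝ] ℂ)
    (ha : ∀ v : Fin k → ι₀, a (fun j ↦ Φ₀ (Pi.single (v j) 1)) ∈ Set.range (algebraMap ℚ ℂ)) :
    IsRationalClass (e (ComplexTorus Φ₀) k
      (ComplexTorus.cconstClass Φ₀ ((γ₀ fun i ↦ Φ₀ (Pi.single (w i) 1)) • a))) := by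
  set g : ℂ := γ₀ fun i ↦ Φ₀ (Pi.single (w i) 1) with hg
  choose q hq using fun u : {u : Fin k → ι₀ // StrictMono u} ↦ ha u.1
  have ha' : a = ∑ u, ((q u : ℚ) : ℂ) • ComplexTorus.latMonomial Φ₀ k u.1 := by
    conv_lhs => rw [← (ComplexTorus.latMonomialBasis Φ₀ k).sum_repr a]
    refine Finset.sum_congr rfl fun u _ ↦ ?_
    rw [ComplexTorus.latMonomialBasis_repr_apply, ComplexTorus.latMonomialBasis_apply, ← hq u]
    rfl
  have hgu : ∀ u : {u : Fin k → ι₀ // StrictMono u}, IsRationalClass (e (ComplexTorus Φ₀) k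
      (ComplexTorus.cconstClass Φ₀ (g • ComplexTorus.latMonomial Φ₀ k u.1))) := fun u ↦ by
    rw [hg, ← ComplexTorus.comp_realRep_elemMatrix Φ₀ γ₀ w u.2]
    exact isRationalClass_cconstClass_comp_realRep₂ Φ₀ Φ₀ he _ hγ₀
  have hsum : g • a = ∑ u, ((q u : ℚ) : ℂ) • (g • ComplexTorus.latMonomial Φ₀ k u.1) := by
    rw [ha', Finset.smul_sum]
    exact Finset.sum_congr rfl fun u _ ↦ smul_comm _ _ _
  have hgu' : ∀ u : {u : Fin k → ι₀ // StrictMono u}, IsRationalClass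
      (g • e (ComplexTorus Φ₀) k (ComplexTorus.cconstClass Φ₀ (ComplexTorus.latMonomial Φ₀ k u.1))) :=
    fun u ↦ by simpa only [map_smul] using hgu u
  rw [hsum, _root_.map_sum, _root_.map_sum]
  simp only [map_smul]
  exact IsRationalClass.sum_smul _ hgu' q

end OneTorus

/-! ### §3 The reference torus `E/Φ₀(ℤᴺ)`: a non-zero rational invariant form in every degree with `Altᵏ ≠ 0`; one scalar per degree -/

section Reference

variable [FiniteDimensional ℂ E] {N : ℕ} (Φ₀ : (Fin N → ℝ) ≃L[ℝ] E)

/-- On the reference torus `E/Φ₀(ℤ^N)` (underlying space literally `Tᴺ = (ℝ/ℤ)ᴺ`), if `Altᵏ_ℝ(E; ℂ) ≠ 0`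
there is a non-zero invariant `k`-form with RATIONAL class under any comparison family `e`: transport a
cup monomial of `Hᵏ(Tᴺ; ℂ)` (a non-zero rational class, `isRationalClass_torusMonomial`) back through
`e` and `cconstClassEquiv`. [cite: HatcherAT2002, §3.2 Example 3.16] -/
theorem exists_ne_zero_isRationalClass_cconstClass (e : ComplexDeRhamIsoFamily E)
    [Nontrivial (E [⋀^Fin k]→L[ℝ] ℂ)] :
    ∃ γ₀ : E [⋀^Fin k]→L[ℝ] ℂ, γ₀ ≠ 0 ∧
      IsRationalClass (e (ComplexTorus Φ₀) k (ComplexTorus.cconstClass Φ₀ γ₀)) := by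
  let L : (E [⋀^Fin k]→L[ℝ] ℂ) ≃ₗ[ℂ] singularCohomology ℂ ℂ (ComplexTorus Φ₀) k :=
    (ComplexTorus.cconstClassEquiv Φ₀ (k := k)).trans (e (ComplexTorus Φ₀) k)
  haveI : Nontrivial (singularCohomology ℂ ℂ (ComplexTorus Φ₀) k) := L.symm.toEquiv.nontrivial
  let b : Module.Basis (Set.powersetCard (Fin N) k) ℂ (singularCohomology ℂ ℂ (ComplexTorus Φ₀) k) :=
    torusMonomialBasis ℂ N k
  obtain ⟨s⟩ := b.index_nonempty
  refine ⟨L.symm (b s), by simpa using b.ne_zero s, ?_⟩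
  have hL : e (ComplexTorus Φ₀) k (ComplexTorus.cconstClass Φ₀ (L.symm (b s))) = b s := by
    change L (L.symm (b s)) = b s
    exact L.apply_symm_apply _
  rw [hL, show b s = torusMonomial ℂ N k (subsetEmb s) from torusMonomialBasis_apply ℂ N k s]
  exact isRationalClass_torusMonomial _

/-- **One scalar per degree.** On the reference torus with a NATURAL family `e`, for every `k` there
is `g ≠ 0` such that `e[g · a]` is a rational class for every invariant `k`-form `a` with rational
values on the lattice tuples. [cite: LangeBirkenhake1992, §1.1.4 Prop. 1.1.20] -/
theorem exists_scale_isRationalClass {e : ComplexDeRhamIsoFamily E} (he : e.IsNatural) (k : ℕ) :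
    ∃ g : ℂ, g ≠ 0 ∧ ∀ a : E [⋀^Fin k]→L[ℝ] ℂ,
      (∀ v : Fin k → Fin N, a (fun j ↦ Φ₀ (Pi.single (v j) 1)) ∈ Set.range (algebraMap ℚ ℂ)) →
        IsRationalClass (e (ComplexTorus Φ₀) k (ComplexTorus.cconstClass Φ₀ (g • a))) := by
  rcases subsingleton_or_nontrivial (E [⋀^Fin k]→L[ℝ] ℂ) with hE | hE
  · refine ⟨1, one_ne_zero, fun a _ ↦ ?_⟩
    have h0 : (1 : ℂ) • a = 0 := Subsingleton.elim _ _
    rw [h0, LinearMap.map_zero, LinearEquiv.map_zero]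
    exact IsRationalClass.zero
  · obtain ⟨γ₀, hγ₀, hrat⟩ := exists_ne_zero_isRationalClass_cconstClass (k := k) Φ₀ e
    obtain ⟨w, hw⟩ : ∃ w, (ComplexTorus.latMonomialBasis Φ₀ k).repr γ₀ w ≠ 0 := by
      by_contra h
      simp only [not_exists, not_not] at h
      exact hγ₀ ((ComplexTorus.latMonomialBasis Φ₀ k).repr.injective
        ((Finsupp.ext h).trans (_root_.map_zero _).symm))
    rw [ComplexTorus.latMonomialBasis_repr_apply] at hw
    exact ⟨_, hw, fun a ha ↦ isRationalClass_cconstClass_coord_smul Φ₀ he hrat w.1 a ha⟩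

end Reference

/-! ### §4 The theorem -/

omit [Fintype ι'] in
/-- The bijection matrix of `β : ι ≃ ι'`: `P e_c = e_{β c}`. [folklore] -/
theorem map_bijMatrix_mulVec_single [DecidableEq ι] [DecidableEq ι'] (β : ι ≃ ι') (c : ι) :
    ((Matrix.of fun (r : ι') (c' : ι) ↦ (if r = β c' then (1 : ℤ) else 0)).map
        (Int.cast : ℤ → ℝ)).mulVec (Pi.single c 1) = Pi.single (β c) 1 := by
  rw [Matrix.mulVec_single_one]
  funext r
  simp only [Matrix.col_apply, Matrix.map_apply, Matrix.of_apply, Pi.single_apply]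
  split_ifs <;> simp

omit [Fintype ι] in
/-- The inverse bijection matrix: `P' e_r = e_{β⁻¹ r}`. [folklore] -/
theorem map_bijMatrix_symm_mulVec_single [DecidableEq ι] [DecidableEq ι'] (β : ι ≃ ι') (r : ι') :
    ((Matrix.of fun (c : ι) (r' : ι') ↦ (if r' = β c then (1 : ℤ) else 0)).map
        (Int.cast : ℤ → ℝ)).mulVec (Pi.single r 1) = Pi.single (β.symm r) 1 := by
  rw [Matrix.mulVec_single_one]
  funext c
  simp only [Matrix.col_apply, Matrix.map_apply, Matrix.of_apply, Pi.single_apply,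
    Equiv.eq_symm_apply]
  split_ifs with h1 h2 h2
  · simp
  · exact absurd h1.symm h2
  · exact absurd h2.symm h1
  · simp

/-- **A natural, rationally normalised complex de Rham family exists — discharge of the named fact
`exists_isRational_complexDeRhamIsoFamily`** (`ConjugationChartExistence`). Proof: take the natural
complexified integration family `e₀` (de Rham's theorem, `exists_complexDeRhamIsoFamily_holds`) and a
reference period isomorphism `Φ₀ : ℝᴺ ≃ E`; by `exists_scale_isRationalClass` there is, in each degree
`k`, a scalar `g_k ≠ 0` with `e₀[g_k · a]` rational for every lattice-rational invariant `k`-form `a`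
on `E/Φ₀(ℤᴺ)`. The rescaled family `e = e₀ ∘ (g_k ·)` is still natural (pull-backs are linear), and it
is rationally normalised on EVERY torus `E/Φ(ℤ^ι)`: a bijection `β : ι ≃ Fin N` gives the smooth map
`mapMatrix P_β : E/Φ(ℤ^ι) → E/Φ₀(ℤᴺ)` with linear lift `S`, `S(Φe_c) = Φ₀e_{β c}`, so a
lattice-rational `a` for `Φ` is `γ ∘ S` with `γ = a ∘ S⁻¹` lattice-rational for `Φ₀`, and
`e₀[g_k · a] = (mapMatrix P_β)^* e₀[g_k · γ]` is rational by naturality. (So the witness is a rational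
rescaling, degree by degree, of the integration family; the period computation identifying `g_k`
with `1` is not needed for the fact.) [cite: GriffithsHarris1978, Ch. 2 §6 (cohomology of complex tori)] -/
theorem exists_isRational_complexDeRhamIsoFamily_holds : exists_isRational_complexDeRhamIsoFamily := by
  intro E _ _ _
  classical
  haveI : FiniteDimensional ℝ E := FiniteDimensional.complexToReal E
  -- the reference period isomorphism `Φ₀ : ℝᴺ ≃ E`
  set N : ℕ := Module.finrank ℝ E with hN
  let Φ₀ : (Fin N → ℝ) ≃L[ℝ] E := (Module.finBasis ℝ E).equivFun.symm.toContinuousLinearEquiv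
  -- the natural family of de Rham's theorem, rescaled degree by degree
  obtain ⟨e₀, he₀⟩ := exists_complexDeRhamIsoFamily_holds E
  choose g hg hP using fun k ↦ exists_scale_isRationalClass Φ₀ he₀ k
  refine ⟨fun M _ _ _ _ _ k ↦ (LinearEquiv.smulOfNeZero ℂ _ (g k) (hg k)).trans (e₀ M k), ?_, ?_⟩
  · intro M M' _ _ _ _ _ _ _ _ _ _ _ f hf k c
    change e₀ M k (g k • complexDeRhamCohomology.map E hf k c) =
      singularCohomology.map ℂ ℂ ⟨f, hf.continuous⟩ k (e₀ M' k (g k • c))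
    rw [← LinearMap.map_smul, he₀]
  · intro k ι _ _ Φ a ha
    change IsRationalClass (e₀ (ComplexTorus Φ) k (g k • ComplexTorus.cconstClass Φ a))
    -- `#ι = N` and a bijection `β : ι ≃ Fin N`
    have hcard : Fintype.card ι = N := by
      rw [← Module.finrank_fintype_fun_eq_card ℝ, Φ.toLinearEquiv.finrank_eq]
    let β : ι ≃ Fin N := Fintype.equivFinOfCardEq hcard
    -- the bijection matrices and their real representations `S : E → E`, `S' : E → E`
    let B : Matrix (Fin N) ι ℤ := Matrix.of fun r c ↦ if r = β c then 1 else 0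
    let B' : Matrix ι (Fin N) ℤ := Matrix.of fun c r ↦ if r = β c then 1 else 0
    let S : E →L[ℝ] E := ComplexTorus.realRep Φ Φ₀ B
    let S' : E →L[ℝ] E := ComplexTorus.realRep Φ₀ Φ B'
    have hS : ∀ c : ι, S (Φ (Pi.single c 1)) = Φ₀ (Pi.single (β c) 1) := fun c ↦ by
      change ComplexTorus.realRep Φ Φ₀ B (Φ (Pi.single c 1)) = _
      rw [ComplexTorus.realRep_apply, map_bijMatrix_mulVec_single]
    have hS' : ∀ r : Fin N, S' (Φ₀ (Pi.single r 1)) = Φ (Pi.single (β.symm r) 1) := fun r ↦ by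
      change ComplexTorus.realRep Φ₀ Φ B' (Φ₀ (Pi.single r 1)) = _
      rw [ComplexTorus.realRep_apply, map_bijMatrix_symm_mulVec_single]
    have hSS : S'.comp S = ContinuousLinearMap.id ℝ E := by
      refine ContinuousLinearMap.coe_injective
        (((Pi.basisFun ℝ ι).map Φ.toLinearEquiv).ext fun c ↦ ?_)
      change S' (S (Φ (Pi.basisFun ℝ ι c))) = Φ (Pi.basisFun ℝ ι c)
      rw [Pi.basisFun_apply, hS, hS', Equiv.symm_apply_apply]
    -- `a = γ ∘ S` with `γ` lattice-rational for `Φ₀`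
    let γ : E [⋀^Fin k]→L[ℝ] ℂ := a.compContinuousLinearMap S'
    have hγ : ∀ v : Fin k → Fin N,
        γ (fun j ↦ Φ₀ (Pi.single (v j) 1)) ∈ Set.range (algebraMap ℚ ℂ) := fun v ↦ by
      change a (S' ∘ fun j ↦ Φ₀ (Pi.single (v j) 1)) ∈ _
      have : (S' ∘ fun j ↦ Φ₀ (Pi.single (v j) 1)) = fun j ↦ Φ (Pi.single (β.symm (v j)) 1) :=
        funext fun j ↦ hS' (v j)
      rw [this]
      exact ha (fun j ↦ β.symm (v j))
    have hγS : (g k • γ).compContinuousLinearMap S = g k • a := by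
      ext v
      change g k • a (S' ∘ (S ∘ v)) = g k • a v
      congr 2
      funext i
      change (S'.comp S) (v i) = v i
      rw [hSS, ContinuousLinearMap.id_apply]
    -- pull back from the reference torus
    have h := isRationalClass_cconstClass_comp_realRep₂ Φ Φ₀ he₀ B (hP k γ hγ)
    rw [← map_smul, ← hγS]
    exact h

/-! ### §5 Consequences for conjugation charts: input (R) discharged -/

/-- **Conjugation charts exist, granted Jouanolou's cohomology chart alone**: input (R) of
`nonempty_conjugationChart_of_facts` is now the theorem `exists_isRational_complexDeRhamIsoFamily_holds`.
[cite: Jouanolou1973, Lemme 1.5] -/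
theorem nonempty_conjugationChart_of_jouanolou (hJ : jouanolou_cohomologyChart) {n : ℕ}
    {X : Motives.SchemeOver ℂ} (hX : Motives.IsSmoothProjective n X) (σ : ℂ ≃+* ℂ) (k : ℕ) :
    Nonempty (ConjugationChart σ X k) :=
  nonempty_conjugationChart_of_facts hJ exists_isRational_complexDeRhamIsoFamily_holds hX σ k

/-- **Conjugate classes exist, granted (J), (G), (C)**: `exists_isConjugateClass_of_facts` with its
input (R) discharged by `exists_isRational_complexDeRhamIsoFamily_holds`.
[cite: CharlesSchnell2014Notes, §11.2.2 (11.2.3)] -/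
theorem exists_isConjugateClass_of_facts' (hJ : jouanolou_cohomologyChart)
    (hG : grothendieck_comparison_realize_surjective) (hC : conj_realize_mem_cclosedSmoothForms) :
    ∀ ⦃n : ℕ⦄ ⦃X : Motives.SchemeOver ℂ⦄, Motives.IsSmoothProjective n X →
      ∀ (σ : ℂ ≃+* ℂ) (k : ℕ) (c : complexBetti X k), ∃ c', IsConjugateClass σ X k c c' :=
  exists_isConjugateClass_of_facts hJ exists_isRational_complexDeRhamIsoFamily_holds hG hC

end HodgeTheory

end Literature.AlgebraicGeometry.HodgeTheory

end
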